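import Summits.QuantumFields.BalabanUV.Beta.GAN24.RespWordCellForm
import Summits.QuantumFields.BalabanUV.Beta.GAN24.RespChargeSym
import Summits.QuantumFields.BalabanUV.Beta.GAN24.WilsonLegCurrent
import Summits.QuantumFields.BalabanUV.Beta.GAN24.PeriodicKKTExchangePairing
import Summits.QuantumFields.BalabanUV.Beta.GAN24.DressedSourceZeroModeLevelZero

/-!
# `BalabanUV.Beta.GAN24.RespWordsLevelZero` — binder row G-an2-4 ∕ (CONV-C), W-slot CT-W, conservation law (C)∕(C)sym, step (L3c) CLOSED of this lineage's note
# `HOME/b2b-balaban-gan24-formalise-leaf-04/g66/CSYM-LEVEL0-KERNEL-BLUEPRINT.md` §8: **THE TWO OUTER-SUMMED SECOND-RESPONSE WORDS OF THE DRESSED LEVEL-0 SOURCE CANCEL** —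
# for every bond `c`, `Σ'_{u′} FF[dM (K2OfK X̃♮_0 Lc S♮_0 M μ c) Lc S♮_0 M ν u′] + Σ'_{u′} FF[dM (K2OfK X̃♮_0 Lc S♮_0 M ν c) Lc S♮_0 M μ u′] = 0` — **SO THE ff ZERO MODE OF THE
# DRESSED LEVEL-0 SOURCE IS THE TWO `S^E ⊗ S^E` NUMBERS ALONE**: `zmode Lc b̃_0 (μ,ν; inl α, inl β) = c·(−(s_f s_m σ₀)²Lc²)·(−K₁²s_f²(E + E′)·½Lc^{d−1}(Lc^{d+1} − Lc^{d−1}))`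
# (pieces (I)+(II) of the level-0 (C_1) balance in CLOSED FORM; 33 `zmode_dressedSource_level0_inl_inl` with its last line evaluated to `0`)

NOT IN PRINT; OUR BOOKKEEPING ([folklore] finite stencil algebra + tsum bookkeeping over TREE objects BY NAME: this lineage's 38 `RespWordCellForm.tsum_respWord_eq_cell`, 39
`RespChargeSym.respCharge_add_swap_eq`, 35 `RespGaugeStencil.SpureRecAt_zero_unitS_inl_inl`, 33 `DressedSourceZeroModeLevelZero.zmode_dressedSource_level0_inl_inl ∕ exists_level0_data`, g64
`WilsonLegCurrent.sum_box_bileg_wilsonA_at`, g65 `PeriodicKKTExchangePairing.sum_box_mul_coord`, 22 `ExchangeSlotResum.face_weight_periodic`, leaf-15∕19's `WilsonVertexSumZero.wilsonA_eq_zero_left ∕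
_right ∕ suppW_subset_box`, an2's `StepJetData.wilsonA_antisymm`, `SpineRecursiveW.locStencil_SpureRecAt ∕ SpureRecAt_translate`, 26 `VHWordsZeroBorder.unitS_translate_block`; G-an2-4 formalisation
swarm, leaf prover `b2b-balaban-gan24-formalise-leaf-04`, gen 67).  HONEST FRAMING (cell contract, verbatim): «discharging `BetaPertH` makes Bałaban's UV stability UNCONDITIONAL — a real
constructive-QFT result; it is NOT the continuum limit and NOT the Clay problem.»  HONEST DEPENDENCY (verbatim): «continuum YM on T⁴ ⇐ BetaPertH ∧ nine spine estimates (0/9 proved);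
BetaPertH ⇐ (D1) ∧ (D4) ∧ CAP+tail; G-an2-4 gates asym, D1 and NE2/3/4.»

WHY (blueprint §9; g64 §7 (7b)'s numerics `|RESP| ≤ 4·10⁻¹⁷`).  By 38 each word is the cell pairing of `chg^{𝒦_μ}_ν` with the currents `Φ_κ`, `Ψ_{ρ′}`; by 39 the symmetrised
charges are `−c₀σ·Σ_{ρ″} chg_{ρ″}·V_{ρ″}`; so the two words sum to `−(c₀σ)² Σ_{ρ″} V_{ρ″}·Σ_{r∈box} 𝟙f(r_{ρ″})·Φ_{ρ″}(r)`, and that cell sum VANISHES (§2: g64's two-leg current +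
telescoping `𝟙f(−1) − 𝟙f(Lc−1) = 0`; `α = β` by antisymmetry).  The VALUE of `Ψ_{ρ′} = FF[M ρ′ 0]` is never needed (blueprint v4 caveat (iv′) is void).

WHAT ([folklore]; generic `d`; in-block root, `1 ≤ Lc`, all units and colour constants; 0 `def`, 0 cited facts, 0 `def … : Prop`, 0 sorry): §1 `hasSum_pair_wilsonA_slot` (slot fixed, both
legs summed: the pair `tsum` is the `box1²` sum), `sum_box1_faceface_wilsonA_diag` (`α = β`: zero), `tsum_twoFace_S0_eq` (the two-leg exit-face current of `S♮_0` in closed form);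
§2 `indicator_neg_one`, `indicator_pred_last`, `sum_range_indicator_shift_sub`, **`sum_box_face_twoFace_S0_eq_zero`** (`Σ_{r∈box Lc} 𝟙f(r_κ)·Φ^{αβ}_κ(r) = 0`, every `κ α β`);
§3 `sum_box_sum_faceCharge_pairing_eq_zero` (finite algebra), **`respWords_add_swap_eq_zero`** (the headline, ANY block-covariant multiplier vertex family `M`);
§4 **`zmode_dressedSource_level0_closed`** (33 in closed form, generic `M M₂ B`), **`zmode_dressedSource_level0_an1_closed`** (at an1's tables = p2's literal source at `j = 0`).
Asserts NO value of Bałaban's tables beyond an3's ∕ an1's DEFINED ones; EVALUATES (I)+(II) of (C_1) at level 0, discharges NOTHING of (C)sym ∕ (Q-D) ∕ (Q-D-rate) ∕ «T2Shape» ∕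
«T2Drift» ∕ (hW, hWall); NEVER «G-an2-4 closed» as (CONV-C); NOT D1, NOT `BetaPertH`, NOT continuum, NOT Clay.  2026-08-23; no existing file touched.
-/
noncomputable section
open Finset
open scoped BigOperators
open Literature.MathematicalPhysics.QuantumFieldTheory
open Literature.MathematicalPhysics.QuantumFieldTheory.Balaban1983to89
open Literature.MathematicalPhysics.QuantumFieldTheory.Balaban1983to89.Beta
open AffineAveraging (Site box toSite)
open B12Sec2to5 (l1)
open ExpKernelCalculus (MKer comp Decays BiLoc VertexFamily shiftK)
open OneStepResolventKernel (Fib LocStencil)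
open OneStepKernelFamily (KInvStep)
open StepJetData (wilsonA wilsonA_antisymm)
open BalabanStepJets (box1)
open SecondOrderResponse (dM K2OfK W2SymOfK LocStencilFM)
open BalabanStepW2 (K3OfK M2Of)
open BalabanStepJetsSucc (mmRead)
open AveragingMixedJetTables (mixFFAt)
open Summit.QuantumFields.BalabanUV.Beta.HessKerDressedUnits (unitK unitS locStencil_unitS)
open Summit.QuantumFields.BalabanUV.Beta.SecondOrderUnits (unitM unitM₂)
open Summit.QuantumFields.BalabanUV.Beta.AxialDressingRooted (coDressKBmAt)
open Summit.QuantumFields.BalabanUV.Beta.SpineRooted (SpureRecAt locStencil_SpureRecAt SpureRecAt_translate M1At vertexFamily_M1At M1At_translate)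
open Summit.QuantumFields.BalabanUV.Beta.GAN24.BiStencilZeroMode (Tab zmode)
open Summit.QuantumFields.BalabanUV.Beta.GAN24.WilsonVertexSumZero (suppW suppW_subset_box wilsonA_eq_zero_left wilsonA_eq_zero_right)
open Summit.QuantumFields.BalabanUV.Beta.GAN24.WilsonLegCurrent (sum_box_bileg_wilsonA_at)
open Summit.QuantumFields.BalabanUV.Beta.GAN24.PeriodicKKTExchangePairing (sum_box_mul_coord)
open Summit.QuantumFields.BalabanUV.Beta.GAN24.ExchangeSlotResum (face_weight_periodic)
open Summit.QuantumFields.BalabanUV.Beta.GAN24.VHWordsZeroBorder (unitS_translate_block)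
open Summit.QuantumFields.BalabanUV.Beta.GAN24.RespGaugeStencil (SpureRecAt_zero_unitS_inl_inl)
open Summit.QuantumFields.BalabanUV.Beta.GAN24.RespWordCellForm (tsum_respWord_eq_cell)
open Summit.QuantumFields.BalabanUV.Beta.GAN24.RespChargeSym (respCharge_add_swap_eq)
open Summit.QuantumFields.BalabanUV.Beta.GAN24.DressedSourceZeroModeLevelZero (zmode_dressedSource_level0_inl_inl zmode_dressedSource_level0_an1_inl_inl)
open SecondOrderResponse (biLoc_smul)
open Summit.QuantumFields.BalabanUV.Beta.HessKerDressedUnits (biLoc_counitK)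
open Summit.QuantumFields.BalabanUV.Beta.SecondOrderUnits (unitM_apply)

namespace Summit.QuantumFields.BalabanUV.Beta.GAN24.RespWordsLevelZero

variable {d : ℕ}

/-! ## §1 The two-leg exit-face current of the level-0 tables in closed form -/

section Current

/-- [folklore] **THE PAIR `tsum` OVER BOTH LEGS OF THE CUBIC WILSON TABLE AT A FIXED SLOT IS THE `box1²` SUM** (both legs lie in `suppW κ u ⊆ u + {−1,0,1}^{d+1}`). -/
theorem hasSum_pair_wilsonA_slot (κ : Fin (d + 1)) (F : Site (d + 1) → Site (d + 1) → ℝ) (u : Site (d + 1)) (a b : Fin (d + 1)) :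
    HasSum (fun yw : Site (d + 1) × Site (d + 1) => F yw.1 yw.2 * wilsonA d κ u yw.1 yw.2 (Sum.inl a) (Sum.inl b))
      (∑ x ∈ box1 (d + 1), ∑ z ∈ box1 (d + 1), F (u + x) (u + z) * wilsonA d κ u (u + x) (u + z) (Sum.inl a) (Sum.inl b)) := by
  classical
  set φ : Site (d + 1) × Site (d + 1) → Site (d + 1) × Site (d + 1) := fun p => (u + p.1, u + p.2) with hφ
  have hinj : Set.InjOn φ ↑(box1 (d + 1) ×ˢ box1 (d + 1)) := by
    intro p _ p' _ h
    simp only [hφ, Prod.mk.injEq, add_right_inj] at h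
    exact Prod.ext h.1 h.2
  have hsupp : ∀ yw ∉ (box1 (d + 1) ×ˢ box1 (d + 1)).image φ, F yw.1 yw.2 * wilsonA d κ u yw.1 yw.2 (Sum.inl a) (Sum.inl b) = 0 := by
    intro yw hyw
    by_contra hne
    have hW : wilsonA d κ u yw.1 yw.2 (Sum.inl a) (Sum.inl b) ≠ 0 := right_ne_zero_of_mul hne
    have hy : yw.1 ∈ suppW κ u := by
      by_contra hy
      exact hW (wilsonA_eq_zero_left κ u hy yw.2 a b)
    have hw : yw.2 ∈ suppW κ u := by
      by_contra hw
      exact hW (wilsonA_eq_zero_right κ u yw.1 hw a b)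
    obtain ⟨x, hx, hxe⟩ := Finset.mem_image.1 (suppW_subset_box κ u hy)
    obtain ⟨z, hz, hze⟩ := Finset.mem_image.1 (suppW_subset_box κ u hw)
    apply hyw
    refine Finset.mem_image.2 ⟨(x, z), Finset.mem_product.2 ⟨hx, hz⟩, ?_⟩
    simp only [hφ]
    rw [hxe, hze]
  have hsum : ∑ yw ∈ (box1 (d + 1) ×ˢ box1 (d + 1)).image φ, F yw.1 yw.2 * wilsonA d κ u yw.1 yw.2 (Sum.inl a) (Sum.inl b) =
      ∑ x ∈ box1 (d + 1), ∑ z ∈ box1 (d + 1), F (u + x) (u + z) * wilsonA d κ u (u + x) (u + z) (Sum.inl a) (Sum.inl b) := by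
    rw [Finset.sum_image hinj, Finset.sum_product]
  rw [← hsum]
  exact hasSum_sum_of_ne_finset_zero hsupp

/-- [folklore] **THE DIAGONAL PATTERN `α = β` OF THE TWO-LEG CURRENT VANISHES** for weights of the same profile on both legs (the table is antisymmetric under the exchange of its legs). -/
theorem sum_box1_faceface_wilsonA_diag (κ : Fin (d + 1)) (P : ℤ → ℝ) (u : Site (d + 1)) (α : Fin (d + 1)) :
    ∑ x ∈ box1 (d + 1), ∑ z ∈ box1 (d + 1), P ((u + x) α) * P ((u + z) α) * wilsonA d κ u (u + x) (u + z) (Sum.inl α) (Sum.inl α) = 0 := by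
  have h : ∑ x ∈ box1 (d + 1), ∑ z ∈ box1 (d + 1), P ((u + x) α) * P ((u + z) α) * wilsonA d κ u (u + x) (u + z) (Sum.inl α) (Sum.inl α) =
      -∑ x ∈ box1 (d + 1), ∑ z ∈ box1 (d + 1), P ((u + x) α) * P ((u + z) α) * wilsonA d κ u (u + x) (u + z) (Sum.inl α) (Sum.inl α) := by
    conv_rhs => rw [Finset.sum_comm]
    rw [← Finset.sum_neg_distrib]
    refine Finset.sum_congr rfl fun x _ => ?_
    rw [← Finset.sum_neg_distrib]
    refine Finset.sum_congr rfl fun z _ => ?_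
    rw [wilsonA_antisymm κ u (u + x) (u + z) (Sum.inl α) (Sum.inl α)]
    ring
  linarith

variable {Lc : ℕ} [NeZero Lc]

/-- [folklore] **THE TWO-LEG EXIT-FACE CURRENT OF `S♮_0` IN CLOSED FORM** (slot `(κ, u)`, read-out faces `α, β`): `Σ'_{(y,w)} 𝟙f(y_α)𝟙f(w_β)·S♮_0 κ u y w (inl α)(inl β)
= (s_f s_m)⁻¹ s_f⁻² cE · Σ_{x,z∈box1} 𝟙f((u+x)_α)𝟙f((u+z)_β)·wilsonA d κ u (u+x)(u+z) (inl α)(inl β)` (`vhSAt` has no field–field block). -/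
theorem tsum_twoFace_S0_eq (ρ : Fin (d + 1) → ℤ) (sf sm cE cVH cΛ : ℝ) (κ α β : Fin (d + 1)) (u : Site (d + 1)) :
    (∑' yw : Site (d + 1) × Site (d + 1), (if yw.1 α % (Lc : ℤ) = (Lc : ℤ) - 1 then (1 : ℝ) else 0) * (if yw.2 β % (Lc : ℤ) = (Lc : ℤ) - 1 then (1 : ℝ) else 0) *
        unitS sf sm (SpureRecAt d Lc ρ cE cVH cΛ 0) κ u yw.1 yw.2 (Sum.inl α) (Sum.inl β)) =
      ((sf * sm)⁻¹ * (sf⁻¹ * sf⁻¹) * cE) * ∑ x ∈ box1 (d + 1), ∑ z ∈ box1 (d + 1),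
        (if (u + x) α % (Lc : ℤ) = (Lc : ℤ) - 1 then (1 : ℝ) else 0) * (if (u + z) β % (Lc : ℤ) = (Lc : ℤ) - 1 then (1 : ℝ) else 0) *
          wilsonA d κ u (u + x) (u + z) (Sum.inl α) (Sum.inl β) := by
  have e : ∀ yw : Site (d + 1) × Site (d + 1), (if yw.1 α % (Lc : ℤ) = (Lc : ℤ) - 1 then (1 : ℝ) else 0) * (if yw.2 β % (Lc : ℤ) = (Lc : ℤ) - 1 then (1 : ℝ) else 0) *
      unitS sf sm (SpureRecAt d Lc ρ cE cVH cΛ 0) κ u yw.1 yw.2 (Sum.inl α) (Sum.inl β) =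
      ((sf * sm)⁻¹ * (sf⁻¹ * sf⁻¹) * cE) * ((if yw.1 α % (Lc : ℤ) = (Lc : ℤ) - 1 then (1 : ℝ) else 0) * (if yw.2 β % (Lc : ℤ) = (Lc : ℤ) - 1 then (1 : ℝ) else 0) *
        wilsonA d κ u yw.1 yw.2 (Sum.inl α) (Sum.inl β)) := by
    intro yw
    rw [SpureRecAt_zero_unitS_inl_inl]
    ring
  simp_rw [e]
  rw [tsum_mul_left, (hasSum_pair_wilsonA_slot κ (fun y w => (if y α % (Lc : ℤ) = (Lc : ℤ) - 1 then (1 : ℝ) else 0) * (if w β % (Lc : ℤ) = (Lc : ℤ) - 1 then (1 : ℝ) else 0))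
    u α β).tsum_eq]

end Current

/-! ## §2 The cell sum of the exit-face-weighted two-leg current vanishes -/

section Cell

variable {Lc : ℕ}

/-- [folklore] `𝟙f(−1) = 1`: `(−1) % Lc = Lc − 1` (`1 ≤ Lc`). -/
theorem indicator_neg_one (hLc : 1 ≤ Lc) : (if (-1 : ℤ) % (Lc : ℤ) = (Lc : ℤ) - 1 then (1 : ℝ) else 0) = 1 := by
  have h : (-1 : ℤ) % (Lc : ℤ) = (Lc : ℤ) - 1 := by
    have e : (-1 : ℤ) = ((Lc : ℤ) - 1) + (-1) * (Lc : ℤ) := by ring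
    rw [e, Int.add_mul_emod_self_right]
    exact Int.emod_eq_of_lt (by omega) (by omega)
  rw [if_pos h]

/-- [folklore] `𝟙f(Lc − 1) = 1`. -/
theorem indicator_pred_last (hLc : 1 ≤ Lc) : (if ((Lc : ℤ) - 1) % (Lc : ℤ) = (Lc : ℤ) - 1 then (1 : ℝ) else 0) = 1 := by
  rw [if_pos (Int.emod_eq_of_lt (by omega) (by omega))]

/-- [folklore] **THE DIFFERENCE PROFILE TELESCOPES OVER ONE PERIOD**: `Σ_{t<Lc} (𝟙f(t − 1) − 𝟙f(t)) = 0`. -/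
theorem sum_range_indicator_shift_sub (hLc : 1 ≤ Lc) :
    ∑ t ∈ Finset.range Lc, ((if ((t : ℤ) - 1) % (Lc : ℤ) = (Lc : ℤ) - 1 then (1 : ℝ) else 0) - (if (t : ℤ) % (Lc : ℤ) = (Lc : ℤ) - 1 then (1 : ℝ) else 0)) = 0 := by
  have h := Finset.sum_range_sub' (fun i : ℕ => (if ((i : ℤ) - 1) % (Lc : ℤ) = (Lc : ℤ) - 1 then (1 : ℝ) else 0)) Lc
  have e : ∀ i : ℕ, (((i + 1 : ℕ) : ℤ) - 1) = (i : ℤ) := fun i => by push_cast; ring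
  simp only [e] at h
  rw [h]
  simp only [Nat.cast_zero, zero_sub]
  rw [indicator_neg_one hLc, indicator_pred_last hLc, sub_self]

variable [NeZero Lc] {r : Fin (d + 1) → ℕ}

/-- [folklore] **THE CELL SUM OF THE EXIT-FACE-WEIGHTED TWO-LEG FACE CURRENT OF `S♮_0` VANISHES** (every slot direction `κ`, every read-out pair `α β`):
`Σ_{r∈box Lc} 𝟙f(r_κ)·Σ'_{(y,w)} 𝟙f(y_α)𝟙f(w_β)·S♮_0 κ r y w (inl α)(inl β) = 0` — `α = β`: the current is zero (antisymmetry); `α ≠ β`: g64's closed form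
`[κ=α]𝟙f(t_α)(𝟙f(t_β−1) − 𝟙f(t_β)) + [κ=β]𝟙f(t_β)(𝟙f(t_α) − 𝟙f(t_α−1))`, the coordinate factorisation of the cell sum and the telescoping of the difference profile. -/
theorem sum_box_face_twoFace_S0_eq_zero (hLc : 1 ≤ Lc) (sf sm cE cVH cΛ : ℝ) (κ α β : Fin (d + 1)) :
    ∑ r' ∈ box (d + 1) Lc, (if toSite r' κ % (Lc : ℤ) = (Lc : ℤ) - 1 then (1 : ℝ) else 0) *
      ∑' yw : Site (d + 1) × Site (d + 1), (if yw.1 α % (Lc : ℤ) = (Lc : ℤ) - 1 then (1 : ℝ) else 0) * (if yw.2 β % (Lc : ℤ) = (Lc : ℤ) - 1 then (1 : ℝ) else 0) *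
        unitS sf sm (SpureRecAt d Lc (toSite r) cE cVH cΛ 0) κ (toSite r') yw.1 yw.2 (Sum.inl α) (Sum.inl β) = 0 := by
  simp_rw [tsum_twoFace_S0_eq]
  by_cases hαβ : α = β
  · subst hαβ
    refine Finset.sum_eq_zero fun r' _ => ?_
    rw [sum_box1_faceface_wilsonA_diag κ (fun n => if n % (Lc : ℤ) = (Lc : ℤ) - 1 then (1 : ℝ) else 0) (toSite r') α, mul_zero, mul_zero]
  · have hb : ∀ r' : Fin (d + 1) → ℕ, ∑ x ∈ box1 (d + 1), ∑ z ∈ box1 (d + 1),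
        (if (toSite r' + x) α % (Lc : ℤ) = (Lc : ℤ) - 1 then (1 : ℝ) else 0) * (if (toSite r' + z) β % (Lc : ℤ) = (Lc : ℤ) - 1 then (1 : ℝ) else 0) *
          wilsonA d κ (toSite r') (toSite r' + x) (toSite r' + z) (Sum.inl α) (Sum.inl β) =
        (if κ = α then (if toSite r' α % (Lc : ℤ) = (Lc : ℤ) - 1 then (1 : ℝ) else 0) *
            ((if (toSite r' β - 1) % (Lc : ℤ) = (Lc : ℤ) - 1 then (1 : ℝ) else 0) - (if toSite r' β % (Lc : ℤ) = (Lc : ℤ) - 1 then (1 : ℝ) else 0)) else 0) +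
          (if κ = β then (if toSite r' β % (Lc : ℤ) = (Lc : ℤ) - 1 then (1 : ℝ) else 0) *
            ((if toSite r' α % (Lc : ℤ) = (Lc : ℤ) - 1 then (1 : ℝ) else 0) - (if (toSite r' α - 1) % (Lc : ℤ) = (Lc : ℤ) - 1 then (1 : ℝ) else 0)) else 0) :=
      fun r' => sum_box_bileg_wilsonA_at hαβ κ (fun n => if n % (Lc : ℤ) = (Lc : ℤ) - 1 then (1 : ℝ) else 0) (fun n => if n % (Lc : ℤ) = (Lc : ℤ) - 1 then (1 : ℝ) else 0) (toSite r')
    rw [Finset.sum_congr rfl fun r' _ => by rw [hb r']]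
    by_cases hκα : κ = α
    · subst hκα
      have h := sum_box_mul_coord (d := d) (N := Lc) hαβ
        (fun n => (if n % (Lc : ℤ) = (Lc : ℤ) - 1 then (1 : ℝ) else 0) * (((sf * sm)⁻¹ * (sf⁻¹ * sf⁻¹) * cE) * (if n % (Lc : ℤ) = (Lc : ℤ) - 1 then (1 : ℝ) else 0)))
        (fun n => (if (n - 1) % (Lc : ℤ) = (Lc : ℤ) - 1 then (1 : ℝ) else 0) - (if n % (Lc : ℤ) = (Lc : ℤ) - 1 then (1 : ℝ) else 0))
      rw [sum_range_indicator_shift_sub hLc, mul_zero] at h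
      refine Eq.trans (Finset.sum_congr rfl fun r' _ => ?_) h
      rw [if_pos rfl, if_neg hαβ, add_zero]
      ring
    · by_cases hκβ : κ = β
      · subst hκβ
        have h := sum_box_mul_coord (d := d) (N := Lc) hκα
          (fun n => (if n % (Lc : ℤ) = (Lc : ℤ) - 1 then (1 : ℝ) else 0) * (((sf * sm)⁻¹ * (sf⁻¹ * sf⁻¹) * cE) * (if n % (Lc : ℤ) = (Lc : ℤ) - 1 then (1 : ℝ) else 0)))
          (fun n => (if n % (Lc : ℤ) = (Lc : ℤ) - 1 then (1 : ℝ) else 0) - (if (n - 1) % (Lc : ℤ) = (Lc : ℤ) - 1 then (1 : ℝ) else 0))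
        have h0 : ∑ t ∈ Finset.range Lc, ((if (t : ℤ) % (Lc : ℤ) = (Lc : ℤ) - 1 then (1 : ℝ) else 0) - (if ((t : ℤ) - 1) % (Lc : ℤ) = (Lc : ℤ) - 1 then (1 : ℝ) else 0)) = 0 := by
          calc ∑ t ∈ Finset.range Lc, ((if (t : ℤ) % (Lc : ℤ) = (Lc : ℤ) - 1 then (1 : ℝ) else 0) - (if ((t : ℤ) - 1) % (Lc : ℤ) = (Lc : ℤ) - 1 then (1 : ℝ) else 0))
              = -∑ t ∈ Finset.range Lc, ((if ((t : ℤ) - 1) % (Lc : ℤ) = (Lc : ℤ) - 1 then (1 : ℝ) else 0) - (if (t : ℤ) % (Lc : ℤ) = (Lc : ℤ) - 1 then (1 : ℝ) else 0)) := by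
                rw [← Finset.sum_neg_distrib]
                exact Finset.sum_congr rfl fun t _ => by ring
            _ = 0 := by rw [sum_range_indicator_shift_sub hLc, neg_zero]
        rw [h0, mul_zero] at h
        refine Eq.trans (Finset.sum_congr rfl fun r' _ => ?_) h
        rw [if_neg hκα, if_pos rfl, zero_add]
        ring
      · refine Finset.sum_eq_zero fun r' _ => ?_
        rw [if_neg hκα, if_neg hκβ, add_zero, mul_zero, mul_zero]

end Cell

/-! ## §3 The two outer-summed second-response words cancel -/

section Words

variable {Lc : ℕ} [NeZero Lc] {r : Fin (d + 1) → ℕ} {M : Fin (d + 1) → Site (d + 1) → MKer (d + 1) (Fib d)} {CM δM : ℝ}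

omit [NeZero Lc] in
/-- [folklore] **FINITE ALGEBRA**: the cell pairing of the symmetrised field-row charges `−K·Σ_{ρ″} 𝟙f(r_κ)c₀[κ=ρ″]σ·V_{ρ″}` with currents `Φ_κ(r)` whose exit-face-weighted cell sums
vanish is `0`. -/
theorem sum_box_sum_faceCharge_pairing_eq_zero (K c₀ σ : ℝ) (V : Fin (d + 1) → ℝ) (Φ : Fin (d + 1) → Site (d + 1) → ℝ)
    (hΦ : ∀ ρ'' : Fin (d + 1), ∑ r' ∈ box (d + 1) Lc, (if toSite r' ρ'' % (Lc : ℤ) = (Lc : ℤ) - 1 then (1 : ℝ) else 0) * Φ ρ'' (toSite r') = 0) :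
    ∑ r' ∈ box (d + 1) Lc, ∑ κ : Fin (d + 1),
        (-(K * ∑ ρ'' : Fin (d + 1), Sum.elim (fun κ' : Fin (d + 1) => if toSite r' κ' % (Lc : ℤ) = (Lc : ℤ) - 1 then c₀ * (if κ' = ρ'' then σ else 0) else 0)
          (fun _ => (0 : ℝ)) (Sum.inl κ : Fib d) * V ρ'')) * Φ κ (toSite r') = 0 := by
  simp only [Sum.elim_inl]
  have e : ∀ (r' : Fin (d + 1) → ℕ) (κ : Fin (d + 1)),
      (-(K * ∑ ρ'' : Fin (d + 1), (if toSite r' κ % (Lc : ℤ) = (Lc : ℤ) - 1 then c₀ * (if κ = ρ'' then σ else 0) else 0) * V ρ'')) * Φ κ (toSite r') =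
        (-(K * (c₀ * σ) * V κ)) * ((if toSite r' κ % (Lc : ℤ) = (Lc : ℤ) - 1 then (1 : ℝ) else 0) * Φ κ (toSite r')) := by
    intro r' κ
    rw [Finset.sum_eq_single κ]
    · simp only [if_true]
      split_ifs <;> ring
    · intro ρ'' _ hρ
      rw [if_neg (Ne.symm hρ)]
      split_ifs <;> ring
    · intro h
      exact absurd (Finset.mem_univ κ) h
  simp_rw [e]
  rw [Finset.sum_comm]
  refine Finset.sum_eq_zero fun κ _ => ?_
  rw [← Finset.mul_sum, hΦ κ, mul_zero]

omit [NeZero Lc] in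
/-- [folklore] **FINITE ALGEBRA, THE ASSEMBLY SHAPE**: two cell pairings whose row charges `Q₁, Q₂` symmetrise to `−K·Σ_{ρ″} chg_{ρ″}·V_{ρ″}` (`chg_{ρ″}(inl κ, t) = 𝟙f(t_κ)c₀[κ=ρ″]σ`,
`chg_{ρ″}(inr ·) = 0`) against currents `Φ` with vanishing exit-face-weighted cell sums and arbitrary multiplier currents `Ψ` add up to `0`. -/
theorem cell_pairing_add_swap_eq_zero {Q₁ Q₂ : Fib d → Site (d + 1) → ℝ} {Φ : Fin (d + 1) → Site (d + 1) → ℝ} {Ψ : Fin (d + 1) → ℝ}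
    (K c₀ σ : ℝ) (V : Fin (d + 1) → ℝ)
    (hQ : ∀ (t : Site (d + 1)) (g : Fib d), Q₁ g t + Q₂ g t =
      -(K * ∑ ρ'' : Fin (d + 1), Sum.elim (fun κ' : Fin (d + 1) => if t κ' % (Lc : ℤ) = (Lc : ℤ) - 1 then c₀ * (if κ' = ρ'' then σ else 0) else 0) (fun _ => (0 : ℝ)) g * V ρ''))
    (hΦ : ∀ ρ'' : Fin (d + 1), ∑ r' ∈ box (d + 1) Lc, (if toSite r' ρ'' % (Lc : ℤ) = (Lc : ℤ) - 1 then (1 : ℝ) else 0) * Φ ρ'' (toSite r') = 0) :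
    ((∑ r' ∈ box (d + 1) Lc, ∑ κ : Fin (d + 1), Q₁ (Sum.inl κ) (toSite r') * Φ κ (toSite r')) + ∑ ρ' : Fin (d + 1), Q₁ (Sum.inr ρ') 0 * Ψ ρ') +
      ((∑ r' ∈ box (d + 1) Lc, ∑ κ : Fin (d + 1), Q₂ (Sum.inl κ) (toSite r') * Φ κ (toSite r')) + ∑ ρ' : Fin (d + 1), Q₂ (Sum.inr ρ') 0 * Ψ ρ') = 0 := by
  have hF : (∑ r' ∈ box (d + 1) Lc, ∑ κ : Fin (d + 1), Q₁ (Sum.inl κ) (toSite r') * Φ κ (toSite r')) +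
      ∑ r' ∈ box (d + 1) Lc, ∑ κ : Fin (d + 1), Q₂ (Sum.inl κ) (toSite r') * Φ κ (toSite r') = 0 := by
    rw [← Finset.sum_add_distrib]
    rw [Finset.sum_congr rfl fun r' _ => (Finset.sum_add_distrib (s := (Finset.univ : Finset (Fin (d + 1))))).symm]
    rw [Finset.sum_congr rfl fun r' _ => Finset.sum_congr rfl fun κ _ => by rw [← add_mul, hQ (toSite r') (Sum.inl κ)]]
    exact sum_box_sum_faceCharge_pairing_eq_zero K c₀ σ V Φ hΦ
  have hM : (∑ ρ' : Fin (d + 1), Q₁ (Sum.inr ρ') 0 * Ψ ρ') + ∑ ρ' : Fin (d + 1), Q₂ (Sum.inr ρ') 0 * Ψ ρ' = 0 := by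
    rw [← Finset.sum_add_distrib]
    refine Finset.sum_eq_zero fun ρ' _ => ?_
    rw [← add_mul, hQ 0 (Sum.inr ρ')]
    simp only [Sum.elim_inr, zero_mul, Finset.sum_const_zero, mul_zero, neg_zero]
  calc _ = ((∑ r' ∈ box (d + 1) Lc, ∑ κ : Fin (d + 1), Q₁ (Sum.inl κ) (toSite r') * Φ κ (toSite r')) +
        ∑ r' ∈ box (d + 1) Lc, ∑ κ : Fin (d + 1), Q₂ (Sum.inl κ) (toSite r') * Φ κ (toSite r')) +
      ((∑ ρ' : Fin (d + 1), Q₁ (Sum.inr ρ') 0 * Ψ ρ') + ∑ ρ' : Fin (d + 1), Q₂ (Sum.inr ρ') 0 * Ψ ρ') := by ring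
    _ = 0 := by rw [hF, hM, add_zero]

/-- [folklore] **THE TWO OUTER-SUMMED SECOND-RESPONSE WORDS OF THE DRESSED LEVEL-0 SOURCE CANCEL** (in-block root, `1 ≤ Lc`, all units and colour constants, ANY multiplier vertex
family `M` at a positive rate that is block-covariant; every axis pattern `(μ,ν;α,β)`, every bond `c`): with `X̃♮_0 = unitK s_f s_m (coDressKBmAt ρ Lc (KInvStep Lc 0))`,
`S♮_0 = unitS s_f s_m (SpureRecAt … 0)`, `FF[V] = Σ'_{(y,w)} 𝟙f(y_α)𝟙f(w_β)·V y w (inl α)(inl β)`: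
`Σ'_{u′} FF[dM (K2OfK X̃♮_0 Lc S♮_0 M μ c) Lc S♮_0 M ν u′] + Σ'_{u′} FF[dM (K2OfK X̃♮_0 Lc S♮_0 M ν c) Lc S♮_0 M μ u′] = 0`. -/
theorem respWords_add_swap_eq_zero (hLc : 1 ≤ Lc) (hr : r ∈ box (d + 1) Lc) (sf sm cE cVH cΛ : ℝ)
    (hM : VertexFamily M Lc CM δM) (hδM : 0 < δM) (hMcov : ∀ (ρ' : Fin (d + 1)) (w t : Site (d + 1)), M ρ' (w + t) = shiftK (-((Lc : ℤ) • t)) (M ρ' w))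
    (μ ν α β : Fin (d + 1)) (c : Site (d + 1)) :
    (∑' u' : Site (d + 1), ∑' yw : Site (d + 1) × Site (d + 1),
        (if yw.1 α % (Lc : ℤ) = (Lc : ℤ) - 1 then (1 : ℝ) else 0) * (if yw.2 β % (Lc : ℤ) = (Lc : ℤ) - 1 then (1 : ℝ) else 0) *
          dM (K2OfK (unitK sf sm (coDressKBmAt (toSite r) Lc (KInvStep (d := d) Lc 0))) Lc (unitS sf sm (SpureRecAt d Lc (toSite r) cE cVH cΛ 0)) M μ c) Lc
            (unitS sf sm (SpureRecAt d Lc (toSite r) cE cVH cΛ 0)) M ν u' yw.1 yw.2 (Sum.inl α) (Sum.inl β)) +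
      ∑' u' : Site (d + 1), ∑' yw : Site (d + 1) × Site (d + 1),
        (if yw.1 α % (Lc : ℤ) = (Lc : ℤ) - 1 then (1 : ℝ) else 0) * (if yw.2 β % (Lc : ℤ) = (Lc : ℤ) - 1 then (1 : ℝ) else 0) *
          dM (K2OfK (unitK sf sm (coDressKBmAt (toSite r) Lc (KInvStep (d := d) Lc 0))) Lc (unitS sf sm (SpureRecAt d Lc (toSite r) cE cVH cΛ 0)) M ν c) Lc
            (unitS sf sm (SpureRecAt d Lc (toSite r) cE cVH cΛ 0)) M μ u' yw.1 yw.2 (Sum.inl α) (Sum.inl β) = 0 := by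
  classical
  obtain ⟨Cs₀, δs₀, hδs₀, hS₀⟩ := locStencil_SpureRecAt (d := d) (Lc := Lc) hLc hr cE cVH cΛ 0
  have hS := locStencil_unitS (sf := sf) (sm := sm) hS₀
  have hScov := unitS_translate_block sf sm (SpureRecAt_translate (d := d) (Lc := Lc) (toSite r) hLc cE cVH cΛ 0)
  have h₁ : ∀ y : Site (d + 1), |(if y α % (Lc : ℤ) = (Lc : ℤ) - 1 then (1 : ℝ) else 0)| ≤ 1 := fun y => by split_ifs <;> simp
  have h₂ : ∀ w : Site (d + 1), |(if w β % (Lc : ℤ) = (Lc : ℤ) - 1 then (1 : ℝ) else 0)| ≤ 1 := fun w => by split_ifs <;> simp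
  have hρ₁ : ∀ y s : Site (d + 1), (if (y + (Lc : ℤ) • s) α % (Lc : ℤ) = (Lc : ℤ) - 1 then (1 : ℝ) else 0) = (if y α % (Lc : ℤ) = (Lc : ℤ) - 1 then (1 : ℝ) else 0) :=
    fun y s => face_weight_periodic Lc α y s
  have hρ₂ : ∀ w s : Site (d + 1), (if (w + (Lc : ℤ) • s) β % (Lc : ℤ) = (Lc : ℤ) - 1 then (1 : ℝ) else 0) = (if w β % (Lc : ℤ) = (Lc : ℤ) - 1 then (1 : ℝ) else 0) :=
    fun w s => face_weight_periodic Lc β w s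
  rw [tsum_respWord_eq_cell hLc hr sf sm 0 hS hδs₀ hScov hM hδM hMcov h₁ h₂ hρ₁ hρ₂ μ ν (Sum.inl α) (Sum.inl β) c,
    tsum_respWord_eq_cell hLc hr sf sm 0 hS hδs₀ hScov hM hδM hMcov h₁ h₂ hρ₁ hρ₂ ν μ (Sum.inl α) (Sum.inl β) c]
  exact cell_pairing_add_swap_eq_zero (Lc := Lc)
    (Q₁ := fun g t => -(∑' s' : Site (d + 1), ∑ b : Fib d,
        comp (unitK sf sm (coDressKBmAt (toSite r) Lc (KInvStep (d := d) Lc 0)))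
          (fun x z a b => ((Lc : ℝ) * (sm * sf)) * ((((Lc ^ (0 + 1) : ℕ) : ℝ)) ^ (d + 1 + 1))⁻¹ *
            ∑' t : Site (d + 1), (if t μ % (Lc : ℤ) = (Lc : ℤ) - 1 then unitS sf sm (SpureRecAt d Lc (toSite r) cE cVH cΛ 0) μ t x z a b else 0)) t s' g b *
          Sum.elim (fun a : Fin (d + 1) => if s' a % (Lc : ℤ) = (Lc : ℤ) - 1 then ((Lc : ℝ) * (sm * sf)) *
            (if a = ν then ((((Lc ^ (0 + 1) : ℕ) : ℝ)) ^ (d + 1 + 1))⁻¹ else 0) else 0) (fun _ => (0 : ℝ)) b))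
    (Q₂ := fun g t => -(∑' s' : Site (d + 1), ∑ b : Fib d,
        comp (unitK sf sm (coDressKBmAt (toSite r) Lc (KInvStep (d := d) Lc 0)))
          (fun x z a b => ((Lc : ℝ) * (sm * sf)) * ((((Lc ^ (0 + 1) : ℕ) : ℝ)) ^ (d + 1 + 1))⁻¹ *
            ∑' t : Site (d + 1), (if t ν % (Lc : ℤ) = (Lc : ℤ) - 1 then unitS sf sm (SpureRecAt d Lc (toSite r) cE cVH cΛ 0) ν t x z a b else 0)) t s' g b *
          Sum.elim (fun a : Fin (d + 1) => if s' a % (Lc : ℤ) = (Lc : ℤ) - 1 then ((Lc : ℝ) * (sm * sf)) *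
            (if a = μ then ((((Lc ^ (0 + 1) : ℕ) : ℝ)) ^ (d + 1 + 1))⁻¹ else 0) else 0) (fun _ => (0 : ℝ)) b))
    (Φ := fun κ t => ∑' yw : Site (d + 1) × Site (d + 1), (if yw.1 α % (Lc : ℤ) = (Lc : ℤ) - 1 then (1 : ℝ) else 0) * (if yw.2 β % (Lc : ℤ) = (Lc : ℤ) - 1 then (1 : ℝ) else 0) *
        unitS sf sm (SpureRecAt d Lc (toSite r) cE cVH cΛ 0) κ t yw.1 yw.2 (Sum.inl α) (Sum.inl β))
    (Ψ := fun ρ' => ∑' yw : Site (d + 1) × Site (d + 1), (if yw.1 α % (Lc : ℤ) = (Lc : ℤ) - 1 then (1 : ℝ) else 0) * (if yw.2 β % (Lc : ℤ) = (Lc : ℤ) - 1 then (1 : ℝ) else 0) *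
        M ρ' 0 yw.1 yw.2 (Sum.inl α) (Sum.inl β))
    (((Lc : ℝ) * (sm * sf)) * ((((Lc ^ (0 + 1) : ℕ) : ℝ)) ^ (d + 1 + 1))⁻¹) ((Lc : ℝ) * (sm * sf)) (((((Lc ^ (0 + 1) : ℕ) : ℝ)) ^ (d + 1 + 1))⁻¹)
    (fun ρ' => (∑' s' : Site (d + 1), (if s' ν % (Lc : ℤ) = (Lc : ℤ) - 1 then
        (((Lc : ℝ) * (sm * sf)) * ((((Lc ^ (0 + 1) : ℕ) : ℝ)) ^ (d + 1 + 1))⁻¹ *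
          ∑' t' : Site (d + 1), (if t' μ % (Lc : ℤ) = (Lc : ℤ) - 1 then unitS sf sm (SpureRecAt d Lc (toSite r) cE cVH cΛ 0) μ t' 0 s' (Sum.inr ρ') (Sum.inl ν) else 0)) else 0)) +
      ∑' s' : Site (d + 1), (if s' μ % (Lc : ℤ) = (Lc : ℤ) - 1 then
        (((Lc : ℝ) * (sm * sf)) * ((((Lc ^ (0 + 1) : ℕ) : ℝ)) ^ (d + 1 + 1))⁻¹ *
          ∑' t' : Site (d + 1), (if t' ν % (Lc : ℤ) = (Lc : ℤ) - 1 then unitS sf sm (SpureRecAt d Lc (toSite r) cE cVH cΛ 0) ν t' 0 s' (Sum.inr ρ') (Sum.inl μ) else 0)) else 0))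
    (fun t g => respCharge_add_swap_eq hLc hr sf sm cE cVH cΛ μ ν t g) (fun ρ'' => sum_box_face_twoFace_S0_eq_zero (r := r) hLc sf sm cE cVH cΛ ρ'' α β)

end Words

/-! ## §4 The ff zero mode of the dressed level-0 source in closed form -/

section Closed

variable {Lc : ℕ} [NeZero Lc] {r : Fin (d + 1) → ℕ}
  {M : Fin (d + 1) → Site (d + 1) → MKer (d + 1) (Fib d)} {CM δM : ℝ}
  {M₂ : Fin (d + 1) → Site (d + 1) → Fin (d + 1) → Site (d + 1) → MKer (d + 1) (Fib d)} {C₂ δ₂ : ℝ}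

/-- [folklore] **THE ff ZERO MODE OF THE DRESSED LEVEL-0 SOURCE IS THE TWO `S^E ⊗ S^E` NUMBERS** (33 `zmode_dressedSource_level0_inl_inl` with the response words evaluated to `0`
by `respWords_add_swap_eq_zero`; same hypotheses as 33: in-block root, `1 ≤ Lc`, all units and colour constants, ANY block-covariant multiplier vertex family `M`, ANY jointly
block-covariant mixed table `M₂`, ANY border `B` without ff block, every axis pattern):
`zmode Lc (c•mmRead Lc (K3OfK X̃♮_0 Lc S♮_0 M W̃) + cB•B)(μ,ν; inl α, inl β) = c·(−(s_f s_m σ₀)²Lc²)·(−K₁²s_f²·E·½Lc^{d−1}(Lc^{d+1} − Lc^{d−1}) + (−K₁²s_f²·E′·½Lc^{d−1}(Lc^{d+1} − Lc^{d−1})))`. -/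
theorem zmode_dressedSource_level0_closed (hLc : 1 ≤ Lc) (hr : r ∈ box (d + 1) Lc) (sf sm cE cVH cΛ : ℝ)
    (hM : VertexFamily M Lc CM δM) (hδM : 0 < δM) (hMcov : ∀ (ρ' : Fin (d + 1)) (w t : Site (d + 1)), M ρ' (w + t) = shiftK (-((Lc : ℤ) • t)) (M ρ' w))
    (hM₂ : LocStencilFM Lc M₂ C₂ δ₂) (hδ₂ : 0 < δ₂)
    (hM₂t : ∀ (κ : Fin (d + 1)) (u : Site (d + 1)) (ρ' : Fin (d + 1)) (w t : Site (d + 1)),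
      M₂ κ (u + (Lc : ℤ) • t) ρ' (w + t) = shiftK (-((Lc : ℤ) • t)) (M₂ κ u ρ' w))
    {B : Tab d} (hBff : ∀ κ u κ' u' x z (α β : Fin (d + 1)), B κ u κ' u' x z (Sum.inl α) (Sum.inl β) = 0) (c cB : ℝ) (μ ν α β : Fin (d + 1)) :
    zmode Lc (fun κ u κ' u' => c • mmRead Lc (K3OfK (unitK sf sm (coDressKBmAt (toSite r) Lc (KInvStep (d := d) Lc 0))) Lc
        (unitS sf sm (SpureRecAt d Lc (toSite r) cE cVH cΛ 0)) M
        (W2SymOfK (unitK sf sm (coDressKBmAt (toSite r) Lc (KInvStep (d := d) Lc 0))) Lc (unitS sf sm (SpureRecAt d Lc (toSite r) cE cVH cΛ 0)) M 0 M₂) κ u κ' u')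
        + cB • B κ u κ' u') μ ν (Sum.inl α) (Sum.inl β) =
      c * (-((sf * sm * ((((Lc ^ (0 + 1) : ℕ) : ℝ)) ^ (d + 1 + 1))⁻¹) * (sf * sm * ((((Lc ^ (0 + 1) : ℕ) : ℝ)) ^ (d + 1 + 1))⁻¹)) * ((Lc : ℝ) * (Lc : ℝ))) *
        (-(((((Lc : ℝ) * (sm * sf)) * ((((Lc ^ (0 + 1) : ℕ) : ℝ)) ^ (d + 1 + 1))⁻¹) * ((sf * sm)⁻¹ * (sf⁻¹ * sf⁻¹) * cE))) ^ 2 * (sf * sf) *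
            (((if μ = ν ∧ α = β then (1 : ℝ) else 0) - (if μ = β ∧ α = ν then (1 : ℝ) else 0)) * ((1 / 2 : ℝ) * (Lc : ℝ) ^ (d - 1) * ((Lc : ℝ) ^ (d + 1) - (Lc : ℝ) ^ (d - 1)))) +
          -(((((Lc : ℝ) * (sm * sf)) * ((((Lc ^ (0 + 1) : ℕ) : ℝ)) ^ (d + 1 + 1))⁻¹) * ((sf * sm)⁻¹ * (sf⁻¹ * sf⁻¹) * cE))) ^ 2 * (sf * sf) *
            (((if ν = μ ∧ α = β then (1 : ℝ) else 0) - (if ν = β ∧ α = μ then (1 : ℝ) else 0)) * ((1 / 2 : ℝ) * (Lc : ℝ) ^ (d - 1) * ((Lc : ℝ) ^ (d + 1) - (Lc : ℝ) ^ (d - 1))))) := by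
  rw [zmode_dressedSource_level0_inl_inl hLc hr sf sm cE cVH cΛ hM hδM hMcov hM₂ hδ₂ hM₂t hBff c cB μ ν α β]
  rw [Finset.sum_eq_zero fun c' _ => respWords_add_swap_eq_zero hLc hr sf sm cE cVH cΛ hM hδM hMcov ν μ α β (toSite c'), mul_zero, sub_zero]

/-- [folklore] **THE SAME AT an1's TABLES** `M = unitM s_f s_m (M1At d Lc ρ cΛ 0)`, `M₂ = unitM₂ s_f s_m (M2Of d Lc (mixFFAt ρ Lc) 0)` — p2's literal source at `j = 0` (33's `_an1` instance; the
border `B` without ff block stays generic). -/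
theorem zmode_dressedSource_level0_an1_closed (hLc : 1 ≤ Lc) (hr : r ∈ box (d + 1) Lc) (sf sm cE cVH cΛ : ℝ)
    {B : Tab d} (hBff : ∀ κ u κ' u' x z (α β : Fin (d + 1)), B κ u κ' u' x z (Sum.inl α) (Sum.inl β) = 0) (c cB : ℝ) (μ ν α β : Fin (d + 1)) :
    zmode Lc (fun κ u κ' u' => c • mmRead Lc (K3OfK (unitK sf sm (coDressKBmAt (toSite r) Lc (KInvStep (d := d) Lc 0))) Lc
        (unitS sf sm (SpureRecAt d Lc (toSite r) cE cVH cΛ 0)) (unitM sf sm (M1At d Lc (toSite r) cΛ 0))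
        (W2SymOfK (unitK sf sm (coDressKBmAt (toSite r) Lc (KInvStep (d := d) Lc 0))) Lc (unitS sf sm (SpureRecAt d Lc (toSite r) cE cVH cΛ 0))
          (unitM sf sm (M1At d Lc (toSite r) cΛ 0)) 0 (unitM₂ sf sm (M2Of d Lc (mixFFAt (toSite r) Lc) 0))) κ u κ' u')
        + cB • B κ u κ' u') μ ν (Sum.inl α) (Sum.inl β) =
      c * (-((sf * sm * ((((Lc ^ (0 + 1) : ℕ) : ℝ)) ^ (d + 1 + 1))⁻¹) * (sf * sm * ((((Lc ^ (0 + 1) : ℕ) : ℝ)) ^ (d + 1 + 1))⁻¹)) * ((Lc : ℝ) * (Lc : ℝ))) *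
        (-(((((Lc : ℝ) * (sm * sf)) * ((((Lc ^ (0 + 1) : ℕ) : ℝ)) ^ (d + 1 + 1))⁻¹) * ((sf * sm)⁻¹ * (sf⁻¹ * sf⁻¹) * cE))) ^ 2 * (sf * sf) *
            (((if μ = ν ∧ α = β then (1 : ℝ) else 0) - (if μ = β ∧ α = ν then (1 : ℝ) else 0)) * ((1 / 2 : ℝ) * (Lc : ℝ) ^ (d - 1) * ((Lc : ℝ) ^ (d + 1) - (Lc : ℝ) ^ (d - 1)))) +
          -(((((Lc : ℝ) * (sm * sf)) * ((((Lc ^ (0 + 1) : ℕ) : ℝ)) ^ (d + 1 + 1))⁻¹) * ((sf * sm)⁻¹ * (sf⁻¹ * sf⁻¹) * cE))) ^ 2 * (sf * sf) *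
            (((if ν = μ ∧ α = β then (1 : ℝ) else 0) - (if ν = β ∧ α = μ then (1 : ℝ) else 0)) * ((1 / 2 : ℝ) * (Lc : ℝ) ^ (d - 1) * ((Lc : ℝ) ^ (d + 1) - (Lc : ℝ) ^ (d - 1))))) := by
  have hM : VertexFamily (unitM sf sm (M1At d Lc (toSite r) cΛ 0)) Lc
      (|(sm * sm)⁻¹| * (max |sf⁻¹| |sm⁻¹| * (|cΛ * BalabanStepW2.wM1 d Lc 0| * (2 * (AveragingHessianKernels.ell (d + 1) Lc : ℝ) ^ 2 * Real.exp (4 * ((d : ℝ) + 1) * Lc * 1))) *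
        max |sf⁻¹| |sm⁻¹|)) 1 :=
    fun ρ' w => biLoc_smul ((sm * sm)⁻¹) (biLoc_counitK (vertexFamily_M1At hLc hr cΛ 0 zero_le_one ρ' w))
  have hMcov : ∀ (ρ' : Fin (d + 1)) (w t : Site (d + 1)),
      unitM sf sm (M1At d Lc (toSite r) cΛ 0) ρ' (w + t) = shiftK (-((Lc : ℤ) • t)) (unitM sf sm (M1At d Lc (toSite r) cΛ 0) ρ' w) := by
    intro ρ' w t
    funext x z a b
    simp only [unitM_apply, shiftK, M1At_translate (Lc := Lc) (toSite r) cΛ 0 ρ' w t]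
  rw [zmode_dressedSource_level0_an1_inl_inl hLc hr sf sm cE cVH cΛ hBff c cB μ ν α β]
  rw [Finset.sum_eq_zero fun c' _ => respWords_add_swap_eq_zero hLc hr sf sm cE cVH cΛ hM one_pos hMcov ν μ α β (toSite c'), mul_zero, sub_zero]

end Closed

end Summit.QuantumFields.BalabanUV.Beta.GAN24.RespWordsLevelZero

end
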